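import Summits.CriticalPhenomena.PercolationContinuityZ3.Theorems.PercNearOneGluingNoHeavyConstsObsConstSharp
import HarnessLib

/-!
# The single-pair functional with a NONEMPTY avoided set: closed form of the level-0 covariances and the upper end `p⋆`
# of the admissible observer constants of MDL(X) (PAPER-2 track (ii): constants of the CSH family)

builds on p205010 (kernel theorem, internal audit signed; external expert review pending).  Support file (`--supports
stmt-CriticalPhenomena-4575`), seat `prim-consts-2`; rows A6/A11 of `run/shared/lean/prim/consts/CONSTANTS.md`, finding F7 of prim-paper-s3.
No definitions, no named facts, no sorries.

Level `0` of the conditioned slack hierarchy (MDL(X)) reads `covD(f, o) ≥ p · covD(f, v)` (`covD = CSH.covD w x Y`, the denominator-free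
covariance under `{x ↮ Y}`; tree constant `p = P(o ∈ C_v | v ↮ {x} ∪ Y)`).  `CSH.covD_nil_pairOpen_eq` (p240936) computed both covariances
at the single-pair functional `f = 1{s(x,v) ∈ 𝐂_x}` for `Y = ∅`; here for an ARBITRARY avoided set `Y` (`e = s(x,v)`, `x ≠ v`, `μ₀` = law
with `e` off, `D = {x ↮ Y}`, `D₁ = {x ↮ Y} ∩ {v ↮ Y}`):
* `Consts.covD_pairOpen_eq`: `covD(f, u) = w_e (1 − w_e) · (μ₀(D) μ₀(D₁ ∩ {x ↔ u ∨ v ↔ u}) − μ₀(D₁) μ₀(D ∩ {x ↔ u}))`;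
* `Consts.covD_pairOpen_cross_eq`: `covD(f, o) · [μ(D₁) μ(D ∩ {x ↮ v})] = covD(f, v) · [μ(D) μ(D₁ ∩ {o ∈ C_x ∪ C_v}) − μ(D₁) μ(D ∩ {x ↔ o})]`
  (`μ` the law of the graph itself): the single-pair ratio is the INTRINSIC number
  `p⋆ := [P(o ∈ C_x ∪ C_v | x ↮ Y, v ↮ Y) − P(o ∈ C_x | x ↮ Y)] / P(v ∉ C_x | x ↮ Y)`, independent of `w_e`;
* `Consts.covD_pairOpen_obs_pos`, `Consts.singleEdge_not_improvable`: for non-degenerate weights `covD(f, v) > 0`, so every constant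
  admissible in the level-0 inequality is `≤ p⋆` (denominator-free) — `p⋆` bounds the sharp observer constant `p_hi` of MDL(X) from above on
  every finite weighted graph (census F7, n ≤ 6: `p_hi = p⋆` in 2 772 / 2 772 level-0 placements; equality in general is OPEN).
For `Y = ∅`, `p⋆ = P(o ∈ C_v | v ∉ C_x) = p` (`CSH.cshMargin_nil_pairOpen_eq_zero`).  Method: pin the pair `e`
(`CSH.integral_indicator_mem_mul_comp_sdiff`, `CSH.integral_indicator_not_mem_mul`), `CSH.reachable_iff_sdiff_pair`, algebra.
[cite: VandenbergHaggstromKahn2005, Thm. 1.3 (p. 6) — context only; the identities are ours (prim-paper-s3 g70 F7.1, this seat)]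
-/
noncomputable section

namespace Summit.CriticalPhenomena.PercolationContinuityZ3.Theorems

open MeasureTheory Set Literature.Probability.LatticeModels Literature.Probability.Percolation
open scoped Classical

namespace Consts

variable {V : Type*} [Fintype V]

omit [Fintype V] in
/-- With the pair `e = s(x,v)` open, `x ↮ Y` iff `x ↮ Y` and `v ↮ Y` after deleting `e`. [folklore] -/
theorem avoid_iff_sdiff_pair {ω : BondConfig V} {x v : V} (Y : Set V) (he : s(x, v) ∈ ω) :
    (∀ y ∈ Y, ¬ (openGraph ω).Reachable x y) ↔
      ∀ y ∈ Y, ¬ (openGraph (ω \ {s(x, v)})).Reachable x y ∧ ¬ (openGraph (ω \ {s(x, v)})).Reachable v y := by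
  constructor
  · intro h y hy
    have h' := h y hy
    rw [CSH.reachable_iff_sdiff_pair y he] at h'
    exact ⟨fun h1 => h' (Or.inl h1), fun h2 => h' (Or.inr h2)⟩
  · intro h y hy hr
    rw [CSH.reachable_iff_sdiff_pair y he] at hr
    exact hr.elim (h y hy).1 (h y hy).2

omit [Fintype V] in
/-- With the pair `e = s(x,v)` open, `v ↔ u` iff `x ↔ u` or `v ↔ u` after deleting `e`. [folklore] -/
theorem reachable_right_iff_sdiff_pair {ω : BondConfig V} {x v : V} (u : V) (he : s(x, v) ∈ ω) :
    (openGraph ω).Reachable v u ↔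
      (openGraph (ω \ {s(x, v)})).Reachable x u ∨ (openGraph (ω \ {s(x, v)})).Reachable v u := by
  have he' : s(v, x) ∈ ω := by rw [Sym2.eq_swap]; exact he
  have h := CSH.reachable_iff_sdiff_pair u he'
  rw [Sym2.eq_swap] at h
  exact h.trans Or.comm

omit [Fintype V] in
/-- The event `{x ↮ Y} ∩ {v ↮ Y}` does not see the state of the pair `s(x,v)`. [folklore] -/
theorem avoid_both_iff_sdiff_pair {ω : BondConfig V} {x v : V} (Y : Set V) (he : s(x, v) ∈ ω) :
    (∀ y ∈ Y, ¬ (openGraph ω).Reachable x y ∧ ¬ (openGraph ω).Reachable v y) ↔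
      ∀ y ∈ Y, ¬ (openGraph (ω \ {s(x, v)})).Reachable x y ∧ ¬ (openGraph (ω \ {s(x, v)})).Reachable v y := by
  constructor
  · intro h y hy
    exact ((avoid_iff_sdiff_pair Y he).1 (fun y' hy' => (h y' hy').1)) y hy
  · intro h y hy
    refine ⟨(avoid_iff_sdiff_pair Y he).2 h y hy, fun hr => ?_⟩
    rw [reachable_right_iff_sdiff_pair y he] at hr
    exact hr.elim (h y hy).1 (h y hy).2

/-- **The two level-0 covariances at the pair functional, avoided set `Y`, in closed form.**  With `e = s(x,v)`, `x ≠ v`,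
`μ = prodBernoulli w`, `μ₀` the same law with `e` switched off, `D = {x ↮ Y}`, `D₁ = {x ↮ Y} ∩ {v ↮ Y}` and `f = 1{e ∈ ·}`:
`covD w x Y f u = w_e (1 − w_e) · (μ₀(D) · μ₀(D₁ ∩ ({x ↔ u} ∪ {v ↔ u})) − μ₀(D₁) · μ₀(D ∩ {x ↔ u}))`.
For `Y = ∅` this is `CSH.covD_nil_pairOpen_eq`. [folklore] -/
theorem covD_pairOpen_eq (w : Sym2 V → unitInterval) (x v u : V) (Y : Set V) (hxv : x ≠ v) :
    CSH.covD w x Y (fun C => if s(x, v) ∈ C then (1 : ℝ) else 0) u =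
      (w s(x, v) : ℝ) * (1 - w s(x, v)) *
        ((prodBernoulli fun d => if d = s(x, v) then 0 else w d).real {ω : BondConfig V | ∀ y ∈ Y, ¬ (openGraph ω).Reachable x y} *
            (prodBernoulli fun d => if d = s(x, v) then 0 else w d).real
              ({ω : BondConfig V | ∀ y ∈ Y, ¬ (openGraph ω).Reachable x y ∧ ¬ (openGraph ω).Reachable v y} ∩
                (openConn x u ∪ openConn v u)) -
          (prodBernoulli fun d => if d = s(x, v) then 0 else w d).real
              {ω : BondConfig V | ∀ y ∈ Y, ¬ (openGraph ω).Reachable x y ∧ ¬ (openGraph ω).Reachable v y} *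
            (prodBernoulli fun d => if d = s(x, v) then 0 else w d).real
              ({ω : BondConfig V | ∀ y ∈ Y, ¬ (openGraph ω).Reachable x y} ∩ openConn x u)) := by
  classical
  set e : Sym2 V := s(x, v) with he_def
  set μ := prodBernoulli w with hμ
  set μ₀ := prodBernoulli (fun d => if d = e then 0 else w d) with hμ₀
  have hmeas : ∀ T : Set (BondConfig V), MeasurableSet T := fun _ => MeasurableSet.of_discrete
  set D : Set (BondConfig V) := {ω | ∀ y ∈ Y, ¬ (openGraph ω).Reachable x y} with hD
  set D₁ : Set (BondConfig V) := {ω | ∀ y ∈ Y, ¬ (openGraph ω).Reachable x y ∧ ¬ (openGraph ω).Reachable v y} with hD₁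
  set gB : BondConfig V → ℝ := (D₁ ∩ (openConn x u ∪ openConn v u)).indicator 1 with hgB
  set gA : BondConfig V → ℝ := (D ∩ openConn x u).indicator 1 with hgA
  set g1 : BondConfig V → ℝ := D₁.indicator 1 with hg1
  set g0 : BondConfig V → ℝ := D.indicator 1 with hg0
  -- the functional read on configurations
  have hf : ∀ ω : BondConfig V, (fun C : Set (Sym2 V) => if s(x, v) ∈ C then (1 : ℝ) else 0) (openEdgeCluster ω x) =
      if e ∈ ω then 1 else 0 := by
    intro ω
    simp only [he_def, CSH.pair_mem_openEdgeCluster_iff hxv]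
  -- on `{e ∈ ω}`: `D` is read off `ω ∖ {e}` as `D₁`, and `x ↔ u` as `x ↔ u ∨ v ↔ u`
  have hDiff : ∀ ω : BondConfig V, e ∈ ω → (ω ∈ D ↔ ω \ {e} ∈ D₁) := fun ω heω => avoid_iff_sdiff_pair Y heω
  have hAiff : ∀ ω : BondConfig V, e ∈ ω → (ω ∈ openConn x u ↔ ω \ {e} ∈ openConn x u ∪ openConn v u) := by
    intro ω heω
    show (openGraph ω).Reachable x u ↔ _
    rw [CSH.reachable_iff_sdiff_pair u heω]
    rfl
  have hDAiff : ∀ ω : BondConfig V, e ∈ ω → (ω ∈ D ∩ openConn x u ↔ ω \ {e} ∈ D₁ ∩ (openConn x u ∪ openConn v u)) := by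
    intro ω heω
    rw [mem_inter_iff, mem_inter_iff, hDiff ω heω, hAiff ω heω]
  have ind1 : ∀ (S : Set (BondConfig V)) (ζ : BondConfig V), ζ ∈ S → S.indicator (1 : BondConfig V → ℝ) ζ = 1 :=
    fun S ζ h => by rw [Set.indicator_of_mem h, Pi.one_apply]
  have ind0 : ∀ (S : Set (BondConfig V)) (ζ : BondConfig V), ζ ∉ S → S.indicator (1 : BondConfig V → ℝ) ζ = 0 :=
    fun S ζ h => by rw [Set.indicator_of_notMem h]
  -- (1) the restricted integral over `D ∩ {x ↔ u}`
  have h1 : ∫ ω in D ∩ openConn x u, (fun C : Set (Sym2 V) => if s(x, v) ∈ C then (1 : ℝ) else 0) (openEdgeCluster ω x) ∂μ =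
      (w e : ℝ) * μ₀.real (D₁ ∩ (openConn x u ∪ openConn v u)) := by
    rw [← integral_indicator (hmeas _)]
    have hpt : ∀ ω : BondConfig V,
        (D ∩ openConn x u).indicator
            (fun ω => (fun C : Set (Sym2 V) => if s(x, v) ∈ C then (1 : ℝ) else 0) (openEdgeCluster ω x)) ω =
          (if e ∈ ω then (1 : ℝ) else 0) * gB (ω \ {e}) := by
      intro ω
      by_cases heω : e ∈ ω
      · by_cases hA : ω ∈ D ∩ openConn x u
        · rw [Set.indicator_of_mem hA, hf, if_pos heω, hgB, ind1 _ _ ((hDAiff ω heω).1 hA)]; ring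
        · rw [Set.indicator_of_notMem hA, hgB, ind0 _ _ (fun h => hA ((hDAiff ω heω).2 h))]; ring
      · by_cases hA : ω ∈ D ∩ openConn x u
        · rw [Set.indicator_of_mem hA, hf, if_neg heω]; ring
        · rw [Set.indicator_of_notMem hA, if_neg heω]; ring
    simp_rw [hpt]
    rw [CSH.integral_indicator_mem_mul_comp_sdiff, hgB, integral_indicator_one (hmeas _)]
  -- (2) the integral over `D`
  have h2 : ∫ ω in D, (fun C : Set (Sym2 V) => if s(x, v) ∈ C then (1 : ℝ) else 0) (openEdgeCluster ω x) ∂μ =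
      (w e : ℝ) * μ₀.real D₁ := by
    rw [← integral_indicator (hmeas _)]
    have hpt : ∀ ω : BondConfig V,
        D.indicator (fun ω => (fun C : Set (Sym2 V) => if s(x, v) ∈ C then (1 : ℝ) else 0) (openEdgeCluster ω x)) ω =
          (if e ∈ ω then (1 : ℝ) else 0) * g1 (ω \ {e}) := by
      intro ω
      by_cases heω : e ∈ ω
      · by_cases hA : ω ∈ D
        · rw [Set.indicator_of_mem hA, hf, if_pos heω, hg1, ind1 _ _ ((hDiff ω heω).1 hA)]; ring
        · rw [Set.indicator_of_notMem hA, hg1, ind0 _ _ (fun h => hA ((hDiff ω heω).2 h))]; ring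
      · by_cases hA : ω ∈ D
        · rw [Set.indicator_of_mem hA, hf, if_neg heω]; ring
        · rw [Set.indicator_of_notMem hA, if_neg heω]; ring
    simp_rw [hpt]
    rw [CSH.integral_indicator_mem_mul_comp_sdiff, hg1, integral_indicator_one (hmeas _)]
  -- (3) the mass of `D ∩ {x ↔ u}`
  have h3 : μ.real (D ∩ openConn x u) =
      (w e : ℝ) * μ₀.real (D₁ ∩ (openConn x u ∪ openConn v u)) + (1 - (w e : ℝ)) * μ₀.real (D ∩ openConn x u) := by
    rw [← integral_indicator_one (hmeas _)]
    have hpt : ∀ ω : BondConfig V, (D ∩ openConn x u).indicator (1 : BondConfig V → ℝ) ω =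
        (if e ∈ ω then (1 : ℝ) else 0) * gB (ω \ {e}) + (if e ∈ ω then (0 : ℝ) else 1) * gA ω := by
      intro ω
      by_cases heω : e ∈ ω
      · by_cases hA : ω ∈ D ∩ openConn x u
        · rw [ind1 _ _ hA, hgB, ind1 _ _ ((hDAiff ω heω).1 hA), hgA, ind1 _ _ hA, if_pos heω, if_pos heω]; ring
        · rw [ind0 _ _ hA, hgB, ind0 _ _ (fun h => hA ((hDAiff ω heω).2 h)), hgA, ind0 _ _ hA]; ring
      · by_cases hA : ω ∈ D ∩ openConn x u
        · rw [ind1 _ _ hA, hgA, ind1 _ _ hA, if_neg heω, if_neg heω]; ring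
        · rw [ind0 _ _ hA, hgA, ind0 _ _ hA, if_neg heω]; ring
    simp_rw [hpt]
    rw [integral_add (Integrable.of_finite) (Integrable.of_finite), CSH.integral_indicator_mem_mul_comp_sdiff,
      CSH.integral_indicator_not_mem_mul, hgB, hgA, integral_indicator_one (hmeas _), integral_indicator_one (hmeas _)]
  -- (4) the mass of `D`
  have h4 : μ.real D = (w e : ℝ) * μ₀.real D₁ + (1 - (w e : ℝ)) * μ₀.real D := by
    rw [← integral_indicator_one (hmeas _)]
    have hpt : ∀ ω : BondConfig V, D.indicator (1 : BondConfig V → ℝ) ω =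
        (if e ∈ ω then (1 : ℝ) else 0) * g1 (ω \ {e}) + (if e ∈ ω then (0 : ℝ) else 1) * g0 ω := by
      intro ω
      by_cases heω : e ∈ ω
      · by_cases hA : ω ∈ D
        · rw [ind1 _ _ hA, hg1, ind1 _ _ ((hDiff ω heω).1 hA), hg0, ind1 _ _ hA, if_pos heω, if_pos heω]; ring
        · rw [ind0 _ _ hA, hg1, ind0 _ _ (fun h => hA ((hDiff ω heω).2 h)), hg0, ind0 _ _ hA]; ring
      · by_cases hA : ω ∈ D
        · rw [ind1 _ _ hA, hg0, ind1 _ _ hA, if_neg heω, if_neg heω]; ring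
        · rw [ind0 _ _ hA, hg0, ind0 _ _ hA, if_neg heω]; ring
    simp_rw [hpt]
    rw [integral_add (Integrable.of_finite) (Integrable.of_finite), CSH.integral_indicator_mem_mul_comp_sdiff,
      CSH.integral_indicator_not_mem_mul, hg1, hg0, integral_indicator_one (hmeas _), integral_indicator_one (hmeas _)]
  -- assemble
  unfold CSH.covD
  rw [h1, h2, h3, h4]
  ring

/-- The pair functional's `v`-covariance: `covD(f, v) = w_e (1 − w_e) · μ₀(D₁) · μ₀(D ∩ {x ↮ v})`. [folklore] -/
theorem covD_pairOpen_self_eq (w : Sym2 V → unitInterval) (x v : V) (Y : Set V) (hxv : x ≠ v) :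
    CSH.covD w x Y (fun C => if s(x, v) ∈ C then (1 : ℝ) else 0) v =
      (w s(x, v) : ℝ) * (1 - w s(x, v)) *
        ((prodBernoulli fun d => if d = s(x, v) then 0 else w d).real
            {ω : BondConfig V | ∀ y ∈ Y, ¬ (openGraph ω).Reachable x y ∧ ¬ (openGraph ω).Reachable v y} *
          (prodBernoulli fun d => if d = s(x, v) then 0 else w d).real
            ({ω : BondConfig V | ∀ y ∈ Y, ¬ (openGraph ω).Reachable x y} ∩ {ω | ¬ (openGraph ω).Reachable x v})) := by
  have hmeas : ∀ T : Set (BondConfig V), MeasurableSet T := fun _ => MeasurableSet.of_discrete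
  rw [covD_pairOpen_eq w x v v Y hxv]
  set μ₀ := prodBernoulli (fun d => if d = s(x, v) then 0 else w d) with hμ₀
  set D : Set (BondConfig V) := {ω | ∀ y ∈ Y, ¬ (openGraph ω).Reachable x y} with hD
  set D₁ : Set (BondConfig V) := {ω | ∀ y ∈ Y, ¬ (openGraph ω).Reachable x y ∧ ¬ (openGraph ω).Reachable v y} with hD₁
  have hB : (openConn x v ∪ openConn v v : Set (BondConfig V)) = Set.univ := by
    ext ω; simp only [Set.mem_union, Set.mem_univ, iff_true]; exact Or.inr (SimpleGraph.Reachable.refl _)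
  have hsplit : μ₀.real (D ∩ openConn x v) + μ₀.real (D ∩ {ω | ¬ (openGraph ω).Reachable x v}) = μ₀.real D := by
    have h := measureReal_inter_add_sdiff (μ := μ₀) (s := D) (hmeas (openConn x v))
    have hset : D \ openConn x v = D ∩ {ω | ¬ (openGraph ω).Reachable x v} := by
      ext ω; simp only [mem_sdiff, mem_inter_iff, mem_setOf_eq]; rfl
    rwa [hset] at h
  rw [hB, Set.inter_univ, ← hsplit]
  ring

/-- **The single-pair ratio is intrinsic (cross identity).**  With `μ = prodBernoulli w` (the law of the graph itself), `x ≠ v`,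
`D = {x ↮ Y}`, `D₁ = {x ↮ Y} ∩ {v ↮ Y}` and `f = 1{s(x,v) ∈ ·}`:
`covD(f, o) · (μ(D₁) · μ(D ∩ {x ↮ v})) = covD(f, v) · (μ(D) · μ(D₁ ∩ ({x ↔ o} ∪ {v ↔ o})) − μ(D₁) · μ(D ∩ {x ↔ o}))`,
i.e. at `f` the level-0 margin vanishes exactly at the constant
`p⋆ = [P(o ∈ C_x ∪ C_v | x ↮ Y, v ↮ Y) − P(o ∈ C_x | x ↮ Y)] / P(v ∉ C_x | x ↮ Y)` (whenever the denominators are nonzero),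
a number independent of the weight of the pair `s(x,v)` itself.  For `Y = ∅`, `p⋆ = P(o ∈ C_v | v ∉ C_x)` is the tree's constant. [folklore] -/
theorem covD_pairOpen_cross_eq (w : Sym2 V → unitInterval) (x o v : V) (Y : Set V) (hxv : x ≠ v) :
    CSH.covD w x Y (fun C => if s(x, v) ∈ C then (1 : ℝ) else 0) o *
        ((prodBernoulli w).real
            {ω : BondConfig V | ∀ y ∈ Y, ¬ (openGraph ω).Reachable x y ∧ ¬ (openGraph ω).Reachable v y} *
          (prodBernoulli w).real
            ({ω : BondConfig V | ∀ y ∈ Y, ¬ (openGraph ω).Reachable x y} ∩ {ω | ¬ (openGraph ω).Reachable x v})) =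
      CSH.covD w x Y (fun C => if s(x, v) ∈ C then (1 : ℝ) else 0) v *
        ((prodBernoulli w).real {ω : BondConfig V | ∀ y ∈ Y, ¬ (openGraph ω).Reachable x y} *
            (prodBernoulli w).real
              ({ω : BondConfig V | ∀ y ∈ Y, ¬ (openGraph ω).Reachable x y ∧ ¬ (openGraph ω).Reachable v y} ∩
                (openConn x o ∪ openConn v o)) -
          (prodBernoulli w).real
              {ω : BondConfig V | ∀ y ∈ Y, ¬ (openGraph ω).Reachable x y ∧ ¬ (openGraph ω).Reachable v y} *
            (prodBernoulli w).real ({ω : BondConfig V | ∀ y ∈ Y, ¬ (openGraph ω).Reachable x y} ∩ openConn x o)) := by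
  classical
  set e : Sym2 V := s(x, v) with he_def
  set μ := prodBernoulli w with hμ
  set μ₀ := prodBernoulli (fun d => if d = e then 0 else w d) with hμ₀
  have hmeas : ∀ T : Set (BondConfig V), MeasurableSet T := fun _ => MeasurableSet.of_discrete
  set D : Set (BondConfig V) := {ω | ∀ y ∈ Y, ¬ (openGraph ω).Reachable x y} with hD
  set D₁ : Set (BondConfig V) := {ω | ∀ y ∈ Y, ¬ (openGraph ω).Reachable x y ∧ ¬ (openGraph ω).Reachable v y} with hD₁
  set N : Set (BondConfig V) := {ω | ¬ (openGraph ω).Reachable x v} with hN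
  set O : Set (BondConfig V) := openConn x o ∪ openConn v o with hO
  rw [covD_pairOpen_eq w x v o Y hxv, covD_pairOpen_self_eq w x v Y hxv]
  have ind1 : ∀ (S : Set (BondConfig V)) (ζ : BondConfig V), ζ ∈ S → S.indicator (1 : BondConfig V → ℝ) ζ = 1 :=
    fun S ζ h => by rw [Set.indicator_of_mem h, Pi.one_apply]
  have ind0 : ∀ (S : Set (BondConfig V)) (ζ : BondConfig V), ζ ∉ S → S.indicator (1 : BondConfig V → ℝ) ζ = 0 :=
    fun S ζ h => by rw [Set.indicator_of_notMem h]
  have hDiff : ∀ ω : BondConfig V, e ∈ ω → (ω ∈ D ↔ ω \ {e} ∈ D₁) := fun ω heω => avoid_iff_sdiff_pair Y heω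
  -- events that do not see the state of `e`: `D₁` and `D₁ ∩ O`
  have hinv : ∀ S : Set (BondConfig V), (∀ ω : BondConfig V, e ∈ ω → (ω ∈ S ↔ ω \ {e} ∈ S)) → μ.real S = μ₀.real S := by
    intro S hS
    rw [← integral_indicator_one (hmeas _), ← integral_indicator_one (hmeas _)]
    set gS : BondConfig V → ℝ := S.indicator 1 with hgS
    have hpt : ∀ ω : BondConfig V, gS ω = (if e ∈ ω then (1 : ℝ) else 0) * gS (ω \ {e}) + (if e ∈ ω then (0 : ℝ) else 1) * gS ω := by
      intro ω
      by_cases heω : e ∈ ω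
      · by_cases hA : ω ∈ S
        · rw [hgS, ind1 _ _ hA, ind1 _ _ ((hS ω heω).1 hA), if_pos heω, if_pos heω]; ring
        · rw [hgS, ind0 _ _ hA, ind0 _ _ (fun h => hA ((hS ω heω).2 h))]; ring
      · rw [if_neg heω, if_neg heω]; ring
    have hint : ∫ ω, gS ω ∂μ = ∫ ω, ((if e ∈ ω then (1 : ℝ) else 0) * gS (ω \ {e}) + (if e ∈ ω then (0 : ℝ) else 1) * gS ω) ∂μ :=
      integral_congr_ae (Filter.Eventually.of_forall hpt)
    rw [hint, integral_add (Integrable.of_finite) (Integrable.of_finite), CSH.integral_indicator_mem_mul_comp_sdiff,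
      CSH.integral_indicator_not_mem_mul]
    ring
  have hD₁iff : ∀ ω : BondConfig V, e ∈ ω → (ω ∈ D₁ ↔ ω \ {e} ∈ D₁) := fun ω heω => avoid_both_iff_sdiff_pair Y heω
  have hD₁inv : μ.real D₁ = μ₀.real D₁ := hinv D₁ hD₁iff
  have hOiff : ∀ ω : BondConfig V, e ∈ ω → (ω ∈ O ↔ ω \ {e} ∈ O) := by
    intro ω heω
    simp only [hO, Set.mem_union]
    show (openGraph ω).Reachable x o ∨ (openGraph ω).Reachable v o ↔
      (openGraph (ω \ {e})).Reachable x o ∨ (openGraph (ω \ {e})).Reachable v o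
    rw [CSH.reachable_iff_sdiff_pair o heω, reachable_right_iff_sdiff_pair o heω]
    tauto
  have hD₁Oinv : μ.real (D₁ ∩ O) = μ₀.real (D₁ ∩ O) :=
    hinv (D₁ ∩ O) (fun ω heω => by rw [mem_inter_iff, mem_inter_iff, hD₁iff ω heω, hOiff ω heω])
  -- events that force `e` closed: `D ∩ N`
  have hDN : μ.real (D ∩ N) = (1 - (w e : ℝ)) * μ₀.real (D ∩ N) := by
    rw [← integral_indicator_one (hmeas _), ← integral_indicator_one (hmeas _)]
    set gS : BondConfig V → ℝ := (D ∩ N).indicator 1 with hgS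
    have hpt : ∀ ω : BondConfig V, gS ω = (if e ∈ ω then (0 : ℝ) else 1) * gS ω := by
      intro ω
      by_cases heω : e ∈ ω
      · have hxv' : (openGraph ω).Reachable x v :=
          SimpleGraph.Adj.reachable ((openGraph_adj ω _ _).2 ⟨heω, hxv⟩)
        have hnot : ω ∉ D ∩ N := fun h => h.2 hxv'
        rw [hgS, ind0 _ _ hnot]; ring
      · rw [if_neg heω]; ring
    have hint : ∫ ω, gS ω ∂μ = ∫ ω, (if e ∈ ω then (0 : ℝ) else 1) * gS ω ∂μ :=
      integral_congr_ae (Filter.Eventually.of_forall hpt)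
    rw [hint, CSH.integral_indicator_not_mem_mul]
  -- events split by the state of `e`: `D` and `D ∩ {x ↔ o}`
  have hAiff : ∀ ω : BondConfig V, e ∈ ω → (ω ∈ D ∩ openConn x o ↔ ω \ {e} ∈ D₁ ∩ O) := by
    intro ω heω
    rw [mem_inter_iff, mem_inter_iff, hDiff ω heω]
    have : ω ∈ openConn x o ↔ ω \ {e} ∈ O := by
      show (openGraph ω).Reachable x o ↔ _
      rw [CSH.reachable_iff_sdiff_pair o heω]; rfl
    rw [this]
  have hsplit : ∀ (S T : Set (BondConfig V)), (∀ ω : BondConfig V, e ∈ ω → (ω ∈ S ↔ ω \ {e} ∈ T)) →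
      μ.real S = (w e : ℝ) * μ₀.real T + (1 - (w e : ℝ)) * μ₀.real S := by
    intro S T hST
    rw [← integral_indicator_one (hmeas S), ← integral_indicator_one (hmeas S), ← integral_indicator_one (hmeas T)]
    set gS : BondConfig V → ℝ := S.indicator 1 with hgS
    set gT : BondConfig V → ℝ := T.indicator 1 with hgT
    have hpt : ∀ ω : BondConfig V, gS ω = (if e ∈ ω then (1 : ℝ) else 0) * gT (ω \ {e}) + (if e ∈ ω then (0 : ℝ) else 1) * gS ω := by
      intro ω
      by_cases heω : e ∈ ω
      · by_cases hA : ω ∈ S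
        · rw [hgS, ind1 _ _ hA, hgT, ind1 _ _ ((hST ω heω).1 hA), if_pos heω, if_pos heω]; ring
        · rw [hgS, ind0 _ _ hA, hgT, ind0 _ _ (fun h => hA ((hST ω heω).2 h))]; ring
      · rw [if_neg heω, if_neg heω]; ring
    have hint : ∫ ω, gS ω ∂μ = ∫ ω, ((if e ∈ ω then (1 : ℝ) else 0) * gT (ω \ {e}) + (if e ∈ ω then (0 : ℝ) else 1) * gS ω) ∂μ :=
      integral_congr_ae (Filter.Eventually.of_forall hpt)
    rw [hint, integral_add (Integrable.of_finite) (Integrable.of_finite), CSH.integral_indicator_mem_mul_comp_sdiff,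
      CSH.integral_indicator_not_mem_mul]
  have hDsplit : μ.real D = (w e : ℝ) * μ₀.real D₁ + (1 - (w e : ℝ)) * μ₀.real D := hsplit D D₁ hDiff
  have hDAsplit : μ.real (D ∩ openConn x o) = (w e : ℝ) * μ₀.real (D₁ ∩ O) + (1 - (w e : ℝ)) * μ₀.real (D ∩ openConn x o) :=
    hsplit _ _ hAiff
  rw [hD₁inv, hD₁Oinv, hDN, hDsplit, hDAsplit]
  ring

/-- **The pair functional's `v`-covariance is positive for non-degenerate weights** (`x ≠ v`, `x, v ∉ Y`, all weights in `(0,1)`):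
the all-closed configuration lies in `D₁` and in `D ∩ {x ↮ v}`. [folklore] -/
theorem covD_pairOpen_obs_pos (w : Sym2 V → unitInterval) (hw : ∀ d, 0 < w d ∧ w d < 1) (x v : V) (Y : Set V) (hxv : x ≠ v)
    (hx : x ∉ Y) (hv : v ∉ Y) :
    0 < CSH.covD w x Y (fun C => if s(x, v) ∈ C then (1 : ℝ) else 0) v := by
  classical
  rw [covD_pairOpen_self_eq w x v Y hxv]
  have h1' : (0 : ℝ) < w s(x, v) := by exact_mod_cast (hw s(x, v)).1
  have h2' : (w s(x, v) : ℝ) < 1 := by exact_mod_cast (hw s(x, v)).2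
  have hlt : ∀ d, (if d = s(x, v) then (0 : unitInterval) else w d) < 1 := fun d => by
    split_ifs
    exacts [zero_lt_one, (hw d).2]
  have hbot : openGraph (∅ : BondConfig V) = ⊥ := by
    unfold openGraph; exact SimpleGraph.fromEdgeSet_empty
  have hnoreach : ∀ a b : V, a ≠ b → ¬ (openGraph (∅ : BondConfig V)).Reachable a b := fun a b hab h => by
    rw [hbot, SimpleGraph.reachable_bot] at h; exact hab h
  refine mul_pos (mul_pos h1' (by linarith)) (mul_pos ?_ ?_)
  · exact CSH.prodBernoulli_real_pos_of_empty_mem _ hlt fun y hy =>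
      ⟨hnoreach x y (fun h => hx (h ▸ hy)), hnoreach v y (fun h => hv (h ▸ hy))⟩
  · exact CSH.prodBernoulli_real_pos_of_empty_mem _ hlt ⟨fun y hy => hnoreach x y (fun h => hx (h ▸ hy)), hnoreach x v hxv⟩

/-- **`p⋆` is an upper end for the admissible observer constants of MDL(X)** (non-degenerate weights, `x ≠ v`, `x, v ∉ Y`).
If a constant `λ` satisfies the level-0 inequality `covD(f, o) − λ · covD(f, v) ≥ 0` at the pair functional `f = 1{s(x,v) ∈ 𝐂_x}`,
then, denominator-free, `λ · (μ(D₁) · μ(D ∩ {x ↮ v})) ≤ μ(D) · μ(D₁ ∩ ({x ↔ o} ∪ {v ↔ o})) − μ(D₁) · μ(D ∩ {x ↔ o})`, i.e.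
`λ ≤ p⋆ = [P(o ∈ C_x ∪ C_v | x ↮ Y, v ↮ Y) − P(o ∈ C_x | x ↮ Y)] / P(v ∉ C_x | x ↮ Y)`.  In particular the sharp (least upper
admissible) observer constant `p_hi` of MDL(X) on any finite weighted graph is at most `p⋆`; for `Y = ∅` this is
`CSH.obsConst_nil_not_improvable` (`p⋆ = p`). [folklore] -/
theorem singleEdge_not_improvable (w : Sym2 V → unitInterval) (hw : ∀ d, 0 < w d ∧ w d < 1) (x o v : V) (Y : Set V)
    (hxv : x ≠ v) (hx : x ∉ Y) (hv : v ∉ Y) (lam : ℝ)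
    (hlam : 0 ≤ CSH.covD w x Y (fun C => if s(x, v) ∈ C then (1 : ℝ) else 0) o -
      lam * CSH.covD w x Y (fun C => if s(x, v) ∈ C then (1 : ℝ) else 0) v) :
    lam * ((prodBernoulli w).real
              {ω : BondConfig V | ∀ y ∈ Y, ¬ (openGraph ω).Reachable x y ∧ ¬ (openGraph ω).Reachable v y} *
            (prodBernoulli w).real
              ({ω : BondConfig V | ∀ y ∈ Y, ¬ (openGraph ω).Reachable x y} ∩ {ω | ¬ (openGraph ω).Reachable x v})) ≤
      (prodBernoulli w).real {ω : BondConfig V | ∀ y ∈ Y, ¬ (openGraph ω).Reachable x y} *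
          (prodBernoulli w).real
            ({ω : BondConfig V | ∀ y ∈ Y, ¬ (openGraph ω).Reachable x y ∧ ¬ (openGraph ω).Reachable v y} ∩
              (openConn x o ∪ openConn v o)) -
        (prodBernoulli w).real
            {ω : BondConfig V | ∀ y ∈ Y, ¬ (openGraph ω).Reachable x y ∧ ¬ (openGraph ω).Reachable v y} *
          (prodBernoulli w).real ({ω : BondConfig V | ∀ y ∈ Y, ¬ (openGraph ω).Reachable x y} ∩ openConn x o) := by
  have hpos := covD_pairOpen_obs_pos w hw x v Y hxv hx hv
  have hcross := covD_pairOpen_cross_eq w x o v Y hxv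
  set cO := CSH.covD w x Y (fun C => if s(x, v) ∈ C then (1 : ℝ) else 0) o with hcO
  set cV := CSH.covD w x Y (fun C => if s(x, v) ∈ C then (1 : ℝ) else 0) v with hcV
  set M := (prodBernoulli w).real
      {ω : BondConfig V | ∀ y ∈ Y, ¬ (openGraph ω).Reachable x y ∧ ¬ (openGraph ω).Reachable v y} *
    (prodBernoulli w).real
      ({ω : BondConfig V | ∀ y ∈ Y, ¬ (openGraph ω).Reachable x y} ∩ {ω | ¬ (openGraph ω).Reachable x v}) with hM
  set R := (prodBernoulli w).real {ω : BondConfig V | ∀ y ∈ Y, ¬ (openGraph ω).Reachable x y} *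
      (prodBernoulli w).real
        ({ω : BondConfig V | ∀ y ∈ Y, ¬ (openGraph ω).Reachable x y ∧ ¬ (openGraph ω).Reachable v y} ∩
          (openConn x o ∪ openConn v o)) -
    (prodBernoulli w).real
        {ω : BondConfig V | ∀ y ∈ Y, ¬ (openGraph ω).Reachable x y ∧ ¬ (openGraph ω).Reachable v y} *
      (prodBernoulli w).real ({ω : BondConfig V | ∀ y ∈ Y, ¬ (openGraph ω).Reachable x y} ∩ openConn x o) with hR
  have hM0 : 0 ≤ M := mul_nonneg measureReal_nonneg measureReal_nonneg
  -- `lam · cV ≤ cO`, multiply by `M ≥ 0` and use `cO · M = cV · R`, then cancel `cV > 0`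
  have h1 : lam * cV * M ≤ cO * M := mul_le_mul_of_nonneg_right (by linarith) hM0
  rw [hcross] at h1
  have h2 : cV * (lam * M) ≤ cV * R := by linarith
  exact le_of_mul_le_mul_left h2 hpos

end Consts

end Summit.CriticalPhenomena.PercolationContinuityZ3.Theorems

end
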